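import Literature.NumberTheory.Automorphic.LocalComponentBJ
import Literature.NumberTheory.Automorphic.AutomorphicRepsGLShiftRealisation
import Literature.NumberTheory.Automorphic.AutomorphicRepsGLAssociatedL2Holds
import Literature.NumberTheory.Automorphic.LocalComponentGenericHolds
import Literature.NumberTheory.Automorphic.AdelicGroupDataAutomorphicMeasureProofs
import HarnessLib

/-!
# Local components of cuspidal Borel–Jacquet data on `GL_n` are generic (Shalika 1974 / Cogdell
# 2004, Thm. 1.1 and §1.2 — for the subquotient model `W / W'`)

Topic `Literature/NumberTheory/Automorphic`; proof file (theorems only: no definition, no named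
fact, no instance), next to `LocalComponentBJ` (the Borel–Jacquet local components
`AutomorphicRepData.HasLocalComponentAt π v ρ` of `π = W / W'`) and `LocalComponentGenericHolds`
(the same genericity for the `L²` model `Π ≤ L²_cusp`, `Shalika1974_isGeneric_of_hasLocalComponentAt_holds`).

**Theorem** (`CuspidalAutomorphicRepData.isGeneric_of_hasLocalComponentAt`). Let `π = W / W'` be a
cuspidal automorphic representation of `GL_n(𝔸_K)` in the sense of Borel–Jacquet (`n ≥ 1`; `W'`
arbitrary, any behaviour on the split centre `A_G`), `v` a finite place and `ρ` an irreducible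
smooth representation of `GL_n(K_v)` which is a local component of `π` at `v`. Then `ρ` is
generic for the local component `ψ_v` of Tate's character (Cogdell 2004, §1.2 p. 179: "`π_v` is
generic for every `v`", from the Fourier–Whittaker expansion of cusp forms, Thm. 1.1; Shalika 1974,
Thm. 5.9).  The printed proof works with a space of cusp forms STABLE under `GL_n(𝔸)`; a
Borel–Jacquet datum is only a subquotient, and the space of cusp forms is not semisimple under
`A_G` (`AutomorphicRepsGLLogDetCounterexample`), so the reduction to the printed setting is the
content of this file:

1. `AutomorphicRepData.IsShiftRealisation.hasLocalComponentAt` — local components pass to the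
   clean model `π₀ = C / ⊥ ≅ W / W'` of `AutomorphicRepsGLShiftRealisation` (Borel–Jacquet 1979,
   4.6 and 5.7; the isomorphism `quotEquiv` commutes with `GL_n(𝔸_K^∞)`,
   `IsShiftRealisation.toQuot_finiteRep`).
2. `AutomorphicRepData.HasLocalComponentAt.map_mulChar` — along a twist `W ↦ W · c`
   (`c = |det|_𝔸^s`), the local component becomes `ρ ⊗ (c ∘ ι_v)` (Arthur–Clozel 1989, Ch. 3 §1).
   With `s n [K:ℚ] = -μ` the clean model becomes `A_G`-invariant
   (`mulChar_detTwist_apply_posRealScalar_mul_of_cpow`, Borel–Jacquet 1979, 5.7).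
3. `AutomorphicRepData.HasLocalComponentAt.toL2` — for a clean `A_G`-invariant cuspidal datum
   `W / ⊥` associated with `Π ≤ L²_cusp` (`IsAssociatedL2`, discharged:
   `AutomorphicRepsGL.exists_isAssociatedL2_holds`), `W = V_Π` and the classes `[f]` of the forms
   `invQuot f ∈ V_Π` give an `L²` local component of `Π` (`invQuot_smul`: `invQuot` intertwines
   `R` with right translation; `invQuot_injective`).
4. `CuspidalAutomorphicRepData.isGeneric_of_hasLocalComponentAt` — the `L²` theorem
   (`isGeneric_of_hasLocalComponentAt_of_zeroDetection` with the proved zero-detection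
   `exists_whittakerCoeff_invQuot_smoothedForm_ne_zero_of_one_le`) for `ρ ⊗ (c ∘ ι_v)`, and the
   twist is removed since `c ∘ ι_v` is trivial on `U_n` (`det = 1`).

## References

* J. W. Cogdell, *Analytic theory of L-functions for GL_n*, in: An Introduction to the Langlands
  Program (2004), Thm. 1.1 (p. 176), §1.2 (p. 179). [CogdellAnalyticTheory2004]
* J. A. Shalika, *The multiplicity one theorem for GL_n*, Ann. of Math. 100 (1974), Thm. 5.9. [Shalika1974]
* A. Borel, H. Jacquet, *Automorphic forms and automorphic representations*, Corvallis 1979, Part 1,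
  §4.6 and 5.7. [BorelJacquetCorvallis1979]
* D. Flath, *Decomposition of representations into tensor products*, Corvallis 1979, Thm. 3. [FlathCorvallis1979]
-/

noncomputable section

open scoped MatrixGroups NNReal Classical
open NumberField IsDedekindDomain MeasureTheory

namespace Literature.NumberTheory.Automorphic

open Literature.NumberTheory.GaloisRepresentations (HeckeCharacter ideleGroup)

variable {n : ℕ} {K : Type} [Field K] [NumberField K] {hcpt : isCompact_glFiniteIntegralLevel n K}

/-! ### 1. Local components pass to the clean model `C / ⊥ ≅ W / W'` -/

namespace AutomorphicRepData

namespace IsShiftRealisation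

variable {π π₀ : AutomorphicRepData (AutomorphyDatum.gl n K hcpt)} {μ : ℂ} {j : ℕ}
  {M : Submodule ℂ ((AdelicGroupData.gl n K).Adelic → ℂ)}

/-- **`C / ⊥ ≅ W / W'` commutes with `GL_n(𝔸_K^∞)`**: `toQuot (r(g) [c]₀) = r(g) (toQuot [c]₀)`
(`N` commutes with right translations and `M` is stable). Borel–Jacquet 1979, 4.6 and 5.7.
[cite: BorelJacquetCorvallis1979, §4.6 and 5.7] -/
theorem toQuot_finiteRep (h : IsShiftRealisation π π₀ μ j M)
    (g : (AutomorphyDatum.gl n K hcpt).finiteAdelic) (q : π₀.Quot) :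
    h.toQuot (π₀.finiteRep g q) = π.finiteRep g (h.toQuot q) := by
  obtain ⟨c, rfl⟩ := Submodule.Quotient.mk_surjective π₀.kerQuot q
  obtain ⟨x, hx, hxc⟩ := h.exists_eq c c.2
  have hgx : rightTranslation (AdelicGroupData.gl n K) (g : (AdelicGroupData.gl n K).Adelic) x ∈ M :=
    h.stableM.finite_stable g g.2 hx
  have hN : shiftPow hcpt μ j
      (rightTranslation (AdelicGroupData.gl n K) (g : (AdelicGroupData.gl n K).Adelic) x) =
        rightTranslation (AdelicGroupData.gl n K) (g : (AdelicGroupData.gl n K).Adelic) c := by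
    rw [shiftPow_rightTranslation, hxc]
  rw [AutomorphicRepData.finiteRep_mk]
  have e1 : h.toQuot (Submodule.Quotient.mk
      ⟨rightTranslation (AdelicGroupData.gl n K) (g : (AdelicGroupData.gl n K).Adelic) c,
        π₀.stable.finite_stable g g.2 c.2⟩) =
      π.mkQ ⟨_, h.M_le hgx⟩ :=
    h.toQuotW_eq_mkQ _ hgx hN
  have e2 : h.toQuot (Submodule.Quotient.mk c) = π.mkQ ⟨x, h.M_le hx⟩ := h.toQuotW_eq_mkQ c hx hxc
  rw [e1, e2, Submodule.mkQ_apply, Submodule.mkQ_apply, AutomorphicRepData.finiteRep_mk]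

/-- **Local components pass to the clean model.** If `π₀ = C / ⊥` realises `π = W / W'` along
`N = S_μ^j` (`IsShiftRealisation`) and `ρ` is a local component of `π` at `v` (Borel–Jacquet model:
a non-zero `GL_n(K_v)`-map `V_ρ → W / W'`), then `ρ` is a local component of `π₀` at `v`: compose
with `W / W' ≅ C / ⊥ = C` (`quotEquiv`, `GL_n(𝔸_K^∞)`-equivariant by `toQuot_finiteRep`).
Borel–Jacquet 1979, 4.6; Flath 1979, Thm. 3. [cite: BorelJacquetCorvallis1979, §4.6 and 5.7] -/
theorem hasLocalComponentAt (h : IsShiftRealisation π π₀ μ j M) {v : HeightOneSpectrum (𝓞 K)}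
    {V : Type*} [AddCommGroup V] [Module ℂ V]
    {ρ : Representation ℂ (GL (Fin n) (v.adicCompletion K)) V} (hρ : π.HasLocalComponentAt v ρ) :
    π₀.HasLocalComponentAt v ρ := by
  obtain ⟨f, hfW, hfW', hf⟩ := hρ
  have hker : π₀.kerQuot = ⊥ := by
    rw [AutomorphicRepData.kerQuot, h.bot, Submodule.comap_bot, Submodule.ker_subtype]
  have hιmem : ∀ g : GL (Fin n) (v.adicCompletion K),
      GLn.ofLocal n K v g ∈ (AutomorphyDatum.gl n K hcpt).finiteAdelic :=
    fun g => GLn.ofLocal_mem_range_ofFinite v g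
  -- `V → W → W / W'`
  obtain ⟨fq, hfq_apply⟩ : ∃ fq : V →ₗ[ℂ] π.Quot, ∀ x, fq x = Submodule.Quotient.mk (p := π.kerQuot)
      ⟨f x, hfW (LinearMap.mem_range_self f x)⟩ :=
    ⟨π.mkQ.comp (LinearMap.codRestrict π.W f fun x => hfW (LinearMap.mem_range_self f x)), fun x => rfl⟩
  -- `C / ⊥ ≅ C`
  obtain ⟨e₀, he₀_mk, he₀_symm⟩ : ∃ e₀ : π₀.Quot ≃ₗ[ℂ] π₀.W,
      (∀ c, e₀ (Submodule.Quotient.mk c) = c) ∧ (∀ c, e₀.symm c = Submodule.Quotient.mk c) :=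
    ⟨Submodule.quotEquivOfEqBot _ hker, fun c => Submodule.quotEquivOfEqBot_apply_mk _ _ c,
      fun c => Submodule.quotEquivOfEqBot_symm_apply _ _ c⟩
  -- the composite `V → W / W' ≅ C / ⊥ ≅ C`
  obtain ⟨c₀, hc₀_apply⟩ : ∃ c₀ : V →ₗ[ℂ] π₀.W, ∀ y, c₀ y = e₀ (h.quotEquiv.symm (fq y)) :=
    ⟨e₀.toLinearMap.comp (h.quotEquiv.symm.toLinearMap.comp fq), fun y => rfl⟩
  have hmk : ∀ x, Submodule.Quotient.mk (p := π₀.kerQuot) (c₀ x) = h.quotEquiv.symm (fq x) := by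
    intro x
    rw [← he₀_symm, hc₀_apply, LinearEquiv.symm_apply_apply]
  -- the `GL_n(K_v)`-action through `ι_v` on the quotients
  have hfq : ∀ (g : GL (Fin n) (v.adicCompletion K)) (x : V),
      fq (ρ g x) = π.finiteRep ⟨GLn.ofLocal n K v g, hιmem g⟩ (fq x) := by
    intro g x
    rw [hfq_apply, hfq_apply, AutomorphicRepData.finiteRep_mk, Submodule.Quotient.eq]
    exact hf g x
  have hquot : ∀ q, h.quotEquiv q = h.toQuot q := fun q => rfl
  have hsymm : ∀ (g : (AutomorphyDatum.gl n K hcpt).finiteAdelic) (q : π.Quot),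
      h.quotEquiv.symm (π.finiteRep g q) = π₀.finiteRep g (h.quotEquiv.symm q) := by
    intro g q
    rw [LinearEquiv.symm_apply_eq, hquot, h.toQuot_finiteRep, ← hquot, LinearEquiv.apply_symm_apply]
  refine ⟨π₀.W.subtype.comp c₀, ?_, ?_, fun g x => ?_⟩
  · rintro _ ⟨x, rfl⟩
    exact Submodule.coe_mem _
  · rw [h.bot]
    intro hle
    obtain ⟨y, hy, hy'⟩ := Set.not_subset.mp hfW'
    obtain ⟨x, rfl⟩ := LinearMap.mem_range.mp hy
    have h0 : (π₀.W.subtype.comp c₀) x = 0 := by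
      have := hle (LinearMap.mem_range_self (π₀.W.subtype.comp c₀) x)
      rwa [Submodule.mem_bot] at this
    have hc0 : c₀ x = 0 := Subtype.ext h0
    have hq0 : fq x = 0 := by
      have := hmk x
      rw [hc0, Submodule.Quotient.mk_zero, eq_comm, LinearEquiv.map_eq_zero_iff] at this
      exact this
    rw [hfq_apply, Submodule.Quotient.mk_eq_zero] at hq0
    exact hy' hq0
  · rw [h.bot, Submodule.mem_bot, sub_eq_zero]
    simp only [LinearMap.coe_comp, Function.comp_apply, Submodule.coe_subtype]
    -- `c₀ (ρ g x) = e₀ (r(ι_v g) [c₀ x]₀) = r(ι_v g) (c₀ x)`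
    have key : c₀ (ρ g x) =
        e₀ (π₀.finiteRep ⟨GLn.ofLocal n K v g, hιmem g⟩ (Submodule.Quotient.mk (p := π₀.kerQuot) (c₀ x))) := by
      rw [hc₀_apply, hfq, hsymm]
      exact congrArg (fun q => e₀ (π₀.finiteRep ⟨GLn.ofLocal n K v g, hιmem g⟩ q)) (hmk x).symm
    rw [AutomorphicRepData.finiteRep_mk, he₀_mk] at key
    rw [key]

end IsShiftRealisation

/-! ### 2. Local components along a twist `W ↦ W · c` -/

/-- **Local components of a twist.** If `π' = (W · c) / (W' · c)` is the twist of `π = W / W'` by a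
character `c` of `GL_n(𝔸_K)` (`mulChar c`; e.g. `c = |det|_𝔸^s`) and `ρ` is a local component of `π`
at `v`, then `ρ ⊗ c_v` (`c_v = c ∘ ι_v`, any character of `GL_n(K_v)` agreeing with it) is a
local component of `π'` at `v`: `x ↦ c · f(x)` intertwines, as
`r(h) (c · φ) = c(h) · (c · r(h) φ)` (`rightTranslation_mulChar`). Arthur–Clozel 1989, Ch. 3 §1
("`(π ⊗ χ)_v = π_v ⊗ χ_v`"); Borel–Jacquet 1979, 5.7. [cite: BorelJacquetCorvallis1979, 5.7] -/
theorem HasLocalComponentAt.map_mulChar {π π' : AutomorphicRepData (AutomorphyDatum.gl n K hcpt)}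
    (c : (AdelicGroupData.gl n K).Adelic →* ℂˣ) (hW : π'.W = π.W.map (mulChar c))
    (hW' : π'.W' = π.W'.map (mulChar c)) {v : HeightOneSpectrum (𝓞 K)}
    (cv : GL (Fin n) (v.adicCompletion K) →* ℂˣ) (hcv : ∀ g, cv g = c (GLn.ofLocal n K v g))
    {V : Type*} [AddCommGroup V] [Module ℂ V]
    {ρ : Representation ℂ (GL (Fin n) (v.adicCompletion K)) V} (hρ : π.HasLocalComponentAt v ρ) :
    π'.HasLocalComponentAt v (ρ.twist cv) := by
  obtain ⟨f, hfW, hfW', hf⟩ := hρ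
  refine ⟨(mulChar c).comp f, ?_, ?_, fun g x => ?_⟩
  · rw [hW, LinearMap.range_comp]
    exact Submodule.map_mono hfW
  · rw [hW', LinearMap.range_comp]
    exact fun hle => hfW' ((Submodule.map_le_map_iff_of_injective (mulChar_injective c) _ _).1 hle)
  · have hfg := hf g x
    rw [hW', LinearMap.comp_apply, LinearMap.comp_apply, Representation.twist_apply, hcv]
    set gι : (AdelicGroupData.gl n K).Adelic := GLn.ofLocal n K v g with hgι
    refine ⟨((c gι : ℂˣ) : ℂ) • (f (ρ g x) - rightTranslation (AdelicGroupData.gl n K) gι (f x)),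
      Submodule.smul_mem _ _ hfg, ?_⟩
    rw [map_smul, map_sub, smul_sub, map_smul, map_smul, rightTranslation_mulChar]

/-! ### 3. From a clean `A_G`-invariant datum to the associated `L²` representation -/

section L2

variable {μ : Measure (AdelicGroupData.gl n K).automorphicQuotient}
  [(AdelicGroupData.gl n K).IsAutomorphicMeasure μ]

/-- **Borel–Jacquet local components are `L²` local components along an association with a clean
datum.** Let `π = W / ⊥` be a clean cuspidal datum associated with the cuspidal
`Π ≤ L²_cusp(GL_n(𝔸_K) ⧸ A_G GL_n(K), μ)` (`IsAssociatedL2 π Π`: `W = ⊥ + V_Π = V_Π`), and `ρ` a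
local component of `π` at `v` with intertwiner `f : V_ρ → W` (exactly equivariant, `W' = ⊥`).
Every `f x ∈ V_Π` is `invQuot F_x` for a unique square-integrable `F_x` with `[F_x] ∈ Π`
(`exists_toLp_mem_of_mem_formsOfL2`, `invQuot_injective`), and `x ↦ [F_x]` is a non-zero
`GL_n(K_v)`-map `V_ρ → Π` along `ι_v`, since `invQuot` intertwines `R` with right translation
(`invQuot_smul`) and the class map is injective on `V_Π`
(`eq_zero_of_toLp_eq_zero_of_invQuot_mem_formsOfL2`).  Borel–Jacquet 1979, 4.6 ("the two notions
of automorphic representation coincide for cuspidal representations"); Flath 1979, Thm. 3.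
[cite: BorelJacquetCorvallis1979, §4.6 and 5.7] -/
theorem HasLocalComponentAt.toL2 {π : CuspidalAutomorphicRepData n K hcpt}
    {P : CuspidalAutomorphicRepGL n K μ} (hbot : π.1.W' = ⊥) (hass : IsAssociatedL2 π P)
    {v : HeightOneSpectrum (𝓞 K)} {V : Type*} [AddCommGroup V] [Module ℂ V]
    {ρ : Representation ℂ (GL (Fin n) (v.adicCompletion K)) V} (hρ : π.1.HasLocalComponentAt v ρ) :
    Automorphic.HasLocalComponentAt P.1 v ρ := by
  obtain ⟨f, hfW, hfW', hf⟩ := hρ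
  have hWV : π.1.W = formsOfL2 hcpt μ P.1 := by
    have h := hass
    rw [IsAssociatedL2, hbot, bot_sup_eq] at h
    exact h
  have hfV : ∀ x, f x ∈ formsOfL2 hcpt μ P.1 := fun x => hWV ▸ hfW (LinearMap.mem_range_self f x)
  have hfeq : ∀ (g : GL (Fin n) (v.adicCompletion K)) (x : V),
      f (ρ g x) = rightTranslation (AdelicGroupData.gl n K) (GLn.ofLocal n K v g) (f x) := by
    intro g x
    have := hf g x
    rwa [hbot, Submodule.mem_bot, sub_eq_zero] at this
  -- representatives
  choose F hF hFP hFeq _ using fun x => exists_toLp_mem_of_mem_formsOfL2 (hfV x)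
  have hFadd : ∀ x y, F (x + y) = F x + F y := fun x y =>
    invQuot_injective _ (by
      rw [← hFeq]
      change f (x + y) = invQuot (AdelicGroupData.gl n K) (F x) + invQuot (AdelicGroupData.gl n K) (F y)
      rw [map_add, hFeq x, hFeq y])
  have hFsmul : ∀ (a : ℂ) x, F (a • x) = a • F x := fun a x =>
    invQuot_injective _ (by
      rw [← hFeq]
      change f (a • x) = a • invQuot (AdelicGroupData.gl n K) (F x)
      rw [map_smul, hFeq x])
  -- the class map `x ↦ [F_x] ∈ Π`
  let Φ : V →ₗ[ℂ] P.1.toSubmodule :=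
    { toFun := fun x => ⟨(hF x).toLp (F x), hFP x⟩
      map_add' := fun x y => by
        refine Subtype.ext ?_
        change (hF (x + y)).toLp (F (x + y)) = (hF x).toLp (F x) + (hF y).toLp (F y)
        rw [← MemLp.toLp_add (hF x) (hF y)]
        exact MemLp.toLp_congr _ _ (Filter.EventuallyEq.of_eq (hFadd x y))
      map_smul' := fun a x => by
        refine Subtype.ext ?_
        change (hF (a • x)).toLp (F (a • x)) = a • (hF x).toLp (F x)
        rw [← MemLp.toLp_const_smul a (hF x)]
        exact MemLp.toLp_congr _ _ (Filter.EventuallyEq.of_eq (hFsmul a x)) }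
  have hΦ : ∀ x, ((Φ x : P.1.toSubmodule) : (AdelicGroupData.gl n K).L2 μ) = (hF x).toLp (F x) :=
    fun x => rfl
  refine ⟨Φ, fun hΦ0 => ?_, fun g x => ?_⟩
  · -- `Φ ≠ 0`
    obtain ⟨y, hy, hy'⟩ := Set.not_subset.mp hfW'
    obtain ⟨x, rfl⟩ := LinearMap.mem_range.mp hy
    have h0 : (hF x).toLp (F x) = 0 := by
      rw [← hΦ x, hΦ0, LinearMap.zero_apply, Submodule.coe_zero]
    have hFx : F x = 0 := eq_zero_of_toLp_eq_zero_of_invQuot_mem_formsOfL2 (hF x) (hFeq x ▸ hfV x) h0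
    refine hy' ?_
    rw [SetLike.mem_coe, hbot, Submodule.mem_bot, hFeq x, hFx]
    rfl
  · -- equivariance: `[F_{ρ(g)x}] = R(ι_v g) [F_x]`
    refine Subtype.ext ?_
    rw [ContRepresentation.ClosedSubrep.coe_toContRep_apply, hΦ, hΦ]
    set gι : (AdelicGroupData.gl n K).Adelic := GLn.ofLocal n K v g with hgι
    have hF' : MemLp (fun y => F x (gι⁻¹ • y)) 2 μ :=
      (hF x).comp_measurePreserving (measurePreserving_smul gι⁻¹ μ)
    have key : (AdelicGroupData.gl n K).rightRegular μ gι ((hF x).toLp (F x)) = hF'.toLp _ := by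
      rw [AdelicGroupData.rightRegular_apply, DomMulAct.mk_smul_toLp]
    rw [key]
    refine MemLp.toLp_congr _ _ (Filter.EventuallyEq.of_eq ?_)
    refine invQuot_injective _ ?_
    rw [invQuot_smul, ← hFeq x, ← hFeq (ρ g x), hfeq]

end L2

end AutomorphicRepData

/-! ### 4. Genericity of the local components of cuspidal Borel–Jacquet data -/

section Generic

variable {F : Type*} [CommRing F] {m : ℕ} {V : Type*} [AddCommGroup V] [Module ℂ V]

/-- **Untwisting a Whittaker functional**: if `ρ ⊗ c` is `ψ`-generic for a character `c` of
`GL_m` trivial on `U_m` (e.g. `c = χ ∘ det`), then `ρ` is `ψ`-generic (same functional, as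
`(ρ ⊗ c)(u) = ρ(u)` on `U_m`). Bushnell–Henniart 2006, §9.1 and §36.1. [folklore] -/
theorem IsGeneric.of_twist_of_forall_eq_one {ρ : Representation ℂ (GL (Fin m) F) V} {c : GL (Fin m) F →* ℂˣ}
    {ψ : AddChar F Circle} (h : IsGeneric (ρ.twist c) ψ)
    (hc : ∀ u ∈ upperUnitriangular (Fin m) F, c u = 1) : IsGeneric ρ ψ := by
  rw [isGeneric_iff] at h ⊢
  obtain ⟨Λ, hΛ, hΛ0⟩ := h
  refine ⟨Λ, (mem_whittakerFunctionals_iff Λ).2 fun u x => ?_, hΛ0⟩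
  have := (mem_whittakerFunctionals_iff Λ).1 hΛ u x
  rwa [Representation.twist_apply, hc u u.2, Units.val_one, one_smul] at this

/-- **`L²` local components are `ψ_v`-generic** — the theorem of `LocalComponentGenericHolds`
(`Shalika1974_isGeneric_of_hasLocalComponentAt_holds`, Cogdell 2004 §1.2 / Shalika 1974 Thm. 5.9)
in the smoothness-only form of `isGeneric_of_hasLocalComponentAt_of_zeroDetection`, with the proved
zero-detection `exists_whittakerCoeff_invQuot_smoothedForm_ne_zero_of_one_le` (`n ≥ 1`) plugged in.
[cite: CogdellAnalyticTheory2004, §1.2 p. 179 (Thm. 1.1 p. 176)] -/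
theorem isGeneric_adicComponent_of_hasLocalComponentAt_L2 [NeZero n]
    {μ : Measure (AdelicGroupData.gl n K).automorphicQuotient} [(AdelicGroupData.gl n K).IsAutomorphicMeasure μ]
    (P : CuspidalAutomorphicRepGL n K μ) (v : HeightOneSpectrum (𝓞 K))
    {V : Type*} [AddCommGroup V] [Module ℂ V]
    (σ : Representation ℂ (GL (Fin n) (v.adicCompletion K)) V) [σ.IsIrreducible] (hsm : σ.IsSmooth)
    (hloc : Automorphic.HasLocalComponentAt P.1 v σ) :
    IsGeneric σ ((adeleAddChar K).adicComponent v) := by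
  have hn : 1 ≤ n := Nat.one_le_iff_ne_zero.2 (NeZero.ne n)
  letI : MeasurableSpace (AdeleRing (𝓞 K) K) := borel _
  haveI : BorelSpace (AdeleRing (𝓞 K) K) := ⟨rfl⟩
  letI : MeasurableSpace (GL (Fin n) (AdeleRing (𝓞 K) K)) := borel _
  haveI : BorelSpace (GL (Fin n) (AdeleRing (𝓞 K) K)) := ⟨rfl⟩
  exact isGeneric_of_hasLocalComponentAt_of_zeroDetection (μ := μ) Measure.haar
    (fun η hη hηs F hF hne =>
      exists_whittakerCoeff_invQuot_smoothedForm_ne_zero_of_one_le hn hη hηs hF hne _)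
    P v σ hsm hloc

/-- **Local components of cuspidal representations (Borel–Jacquet data) on `GL_n` are generic.**
Let `π = W / W'` be a cuspidal automorphic representation of `GL_n(𝔸_K)` (`n ≥ 1`), `v` a finite
place and `ρ` an irreducible smooth local component of `π` at `v`. Then `ρ` is generic for the
local component `ψ_v` of Tate's character `adeleAddChar K`.  In print (Cogdell 2004, §1.2 p. 179;
Shalika 1974, Thm. 5.9) for stable spaces of cusp forms; the reduction of the subquotient model to
that setting is §§1–3 of this file: clean model (`exists_isShiftRealisation_of_sSup_irreducible`,
semisimplicity of `A_G`-invariant cusp forms `stable_cuspidal_eq_sSup_irreducible_holds`), twist by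
`|det|_𝔸^s` to reach `A_G`-invariance, association with `Π ≤ L²_cusp`
(`exists_isAssociatedL2_holds`), the `L²` theorem (`isGeneric_of_hasLocalComponentAt_of_zeroDetection`
with `exists_whittakerCoeff_invQuot_smoothedForm_ne_zero_of_one_le`), untwist (`det = 1` on `U_n`).
[cite: CogdellAnalyticTheory2004, §1.2 p. 179 (Thm. 1.1 p. 176)] [cite: Shalika1974, §5 Thm. 5.9] -/
theorem CuspidalAutomorphicRepData.isGeneric_of_hasLocalComponentAt [NeZero n]
    (π : CuspidalAutomorphicRepData n K hcpt) (v : HeightOneSpectrum (𝓞 K))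
    {V : Type*} [AddCommGroup V] [Module ℂ V]
    (ρ : Representation ℂ (GL (Fin n) (v.adicCompletion K)) V) [ρ.IsIrreducible] (hsm : ρ.IsSmooth)
    (hloc : π.1.HasLocalComponentAt v ρ) :
    IsGeneric ρ ((adeleAddChar K).adicComponent v) := by
  classical
  -- 1. the clean model `π₀ = C / ⊥`, `A_G` acting by `a ↦ a^μ₀`
  obtain ⟨π₀, μ₀, j, M, hsh⟩ := π.exists_isShiftRealisation_of_sSup_irreducible
    AutomorphicRepsGL.stable_cuspidal_eq_sSup_irreducible_holds
  have h0 : π₀.1.HasLocalComponentAt v ρ := hsh.hasLocalComponentAt hloc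
  -- 2. the twist by `|det|_𝔸^s`, `s n [K:ℚ] = -μ₀`, is clean and `A_G`-invariant
  have hN : ((n * Module.finrank ℚ K : ℕ) : ℂ) ≠ 0 := by
    exact_mod_cast (Nat.mul_ne_zero (NeZero.ne n) Module.finrank_pos.ne')
  set s : ℂ := -μ₀ / ((n * Module.finrank ℚ K : ℕ) : ℂ) with hs_def
  have hs : s * (n * Module.finrank ℚ K : ℕ) = -μ₀ := by
    rw [hs_def, div_mul_cancel₀ _ hN]
  obtain ⟨χ, hχ⟩ := exists_heckeCharacter_ideleNorm_cpow K s
  obtain ⟨π₁, hW₁, hW₁'⟩ := exists_cuspidalAutomorphicRepData_map_mulChar_detTwist hχ π₀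
  obtain ⟨cχ, hcχ⟩ : ∃ cv : GL (Fin n) (v.adicCompletion K) →* ℂˣ,
      ∀ g, cv g = detTwist n χ (GLn.ofLocal n K v g) :=
    ⟨(detTwist n χ).comp (GLn.ofLocal n K v), fun g => rfl⟩
  have h1 : π₁.1.HasLocalComponentAt v (ρ.twist cχ) := h0.map_mulChar (detTwist n χ) hW₁ hW₁' cχ hcχ
  have hbot₁ : π₁.1.W' = ⊥ := by rw [hW₁', hsh.bot, Submodule.map_bot]
  have hinv₁ : ∀ φ ∈ π₁.1.W, ∀ z ∈ (AdelicGroupData.gl n K).center', ∀ g, φ (z * g) = φ g := by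
    intro φ hφ z hz g
    rw [hW₁] at hφ
    obtain ⟨c, hc, rfl⟩ := hφ
    obtain ⟨t, rfl⟩ := hz
    exact mulChar_detTwist_apply_posRealScalar_mul_of_cpow hχ hs
      (fun t' g' => hsh.apply_posRealScalar_mul hc t' g') t g
  -- 3. the associated `L²` representation and its local component `ρ ⊗ cχ`
  obtain ⟨μA, hμA⟩ := AdelicGroupData.exists_isAutomorphicMeasure_gl_holds (n := n) (K := K)
  haveI := hμA
  obtain ⟨P, hP⟩ := AutomorphicRepsGL.exists_isAssociatedL2_holds (hcpt := hcpt) (μ := μA) π₁ hinv₁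
  have h2 : Automorphic.HasLocalComponentAt P.1 v (ρ.twist cχ) := h1.toL2 hbot₁ hP
  -- 4. `ρ ⊗ cχ` is irreducible and smooth (`cχ` is trivial on the open subgroup `GL_n(𝒪_v)`)
  haveI : (ρ.twist cχ).IsIrreducible := ρ.isIrreducible_twist cχ
  have hker : IsOpen ((cχ.ker : Subgroup (GL (Fin n) (v.adicCompletion K))) :
      Set (GL (Fin n) (v.adicCompletion K))) := by
    refine Subgroup.isOpen_mono (H₁ := valuedCongruenceSubgroup (Fin n) (1 : WithZero (Multiplicative ℤ)))
      (fun k hk => ?_) (isOpen_valuedCongruenceSubgroup n K v one_ne_zero)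
    rw [MonoidHom.mem_ker, hcχ, detTwist_apply']
    exact apply_det_eq_one_of_mem_finiteLevelsGL hχ (glIntegralLevel_mem_finiteLevelsGL n K hcpt)
      (isMaximalAt_glIntegralLevel n K v ⟨k, hk, rfl⟩)
  have hsm' : (ρ.twist cχ).IsSmooth := hsm.twist hker
  -- 5. the `L²` genericity theorem (zero-detection by Whittaker coefficients is proved for `n ≥ 1`)
  have hgen : IsGeneric (ρ.twist cχ) ((adeleAddChar K).adicComponent v) :=
    isGeneric_adicComponent_of_hasLocalComponentAt_L2 P v (ρ.twist cχ) hsm' h2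
  -- 6. untwist: `cχ = |det|^s ∘ ι_v` is trivial on `U_n`
  refine hgen.of_twist_of_forall_eq_one fun u hu => ?_
  rw [hcχ]
  change χ (Matrix.GeneralLinearGroup.det (GLn.ofLocal n K v u)) = 1
  rw [GLn.det_ofLocal, det_eq_one_of_mem_upperUnitriangular hu, map_one, map_one]

/-- **Packaged form**: an irreducible smooth Borel–Jacquet local component of a cuspidal `π` on
`GL_n(𝔸_K)` (`n ≥ 1`) is generic for some non-trivial continuous additive character of `K_v` — the
shape of the genericity hypotheses of `IsLocalLanglandsGL.lFactor_pairs` / `epsilon_pairs`.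
[cite: CogdellAnalyticTheory2004, §1.2 p. 179 (Thm. 1.1 p. 176)] -/
theorem CuspidalAutomorphicRepData.exists_isGeneric_of_hasLocalComponentAt [NeZero n]
    (π : CuspidalAutomorphicRepData n K hcpt) (v : HeightOneSpectrum (𝓞 K))
    {V : Type*} [AddCommGroup V] [Module ℂ V]
    (ρ : Representation ℂ (GL (Fin n) (v.adicCompletion K)) V) [ρ.IsIrreducible] (hsm : ρ.IsSmooth)
    (hloc : π.1.HasLocalComponentAt v ρ) :
    ∃ ψ : AddChar (v.adicCompletion K) Circle, ψ.IsContinuousNontrivial ∧ IsGeneric ρ ψ :=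
  ⟨(adeleAddChar K).adicComponent v,
    (isGlobalAddChar_adeleAddChar K).isContinuousNontrivial_adicComponent
      (adicComponent_adeleAddChar_ne_one v),
    π.isGeneric_of_hasLocalComponentAt v ρ hsm hloc⟩

end Generic

end Literature.NumberTheory.Automorphic

end
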